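import Literature.NumberTheory.EllipticCurves.BurungaleSkinnerTianWan2024.OrdinaryTwoVariableMainStatementSemistableOPEN
import HarnessLib

/-!
# Burungale–Skinner–Tian–Wan (arXiv:2409.01350v2, PREPRINT), §10.2.2 Thm. 10.5 (label `KoMC'_lb`,
# pp. 87–88): "An Eisenstein congruence divisibility" — the TWO-VARIABLE divisibility
# `𝓛_p(g_{/L}) ∣ ξ(X(g_{/L}))` in `Λ_L` for a SEMISTABLE elliptic newform over an imaginary quadratic
# field `L` under (def)/(indef), ORDINARY case `∘ = ∅`, plus the quadratic-twist clause, as explicitly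
# labelled OPEN binders (claim-tagged; NEVER facts) over the tree's refereed Yan–Zhu 2026 carriers

Written by the typer seat `bsd-littype-01` (gen 8) of the cross-ladder literature-typing layer
(D-0088(4); cell `run/shared/lean/pub/bsd-littype/`). D-0064: one file for §10.2.2 (ordinary case). The
gen-7 sibling `OrdinaryTwoVariableMainStatementSemistableOPEN.lean` types Thm. 10.10 (b) (the two
EQUALITIES 9.10-`∅` / 9.12-`∅` under the same hypotheses); THIS file types the intermediate theorem of
BSTW's proof template, whose conclusion is the one-sided half `Char(X) ⊂ (𝓛)` (`IdealLeSpan`) of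
9.10-`∅` (b). HONEST FRAMING: UNREFEREED preprint ⇒ explicitly labelled OPEN hypotheses only
(`def … : Prop`, `[claim: …, status: under-review]`), NEVER theorems, NEVER `[cite:]`-facts; nothing
asserted about any curve; nothing booked; no `_holds`. No new notion: the hypothesis block is the
sibling's `Thm1010bHypotheses` (see "Hypotheses" below for the one-field delta to print), the objects
are the sibling's (`XOrd₂`, `IsHidaRankinLFunction`, `perrinRiouLFunction`).

WHY THIS BINDER (the typing layer's located finding, gen 8): Thm. 10.10 (b) is proved in print by "One
may proceed just as in the proof of Theorem 10.8" (p. 89, tex l.7528), i.e. (proof of Thm. 10.8,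
pp. 88–89, tex l.7496–7514): cyclotomic equality for `g` AND `g ⊗ χ_L` (Thm. 10.10 (a) = the gen-6
binders `thm1010a_mainStatement_semistable_ordinary_OPEN` / `thm1010_twist_mainStatement_OPEN`, BOTH
derived in the tree from [SU14] Thm. 3.6.9 by `…OfSkinnerUrbanProofs.lean` /
`…TwistOfSkinnerUrbanProofs.lean`) + Lemma 9.17 (i) + THIS two-variable divisibility + the
non-vanishing of `𝓛_p^{cyc}` + [SU, Lem. 3.2]. Every step of that template EXCEPT Thm. 10.5 is refereed
print already in the tree (Yan–Zhu 2026 Lemma 5.3 / Prop. 3.7 / Cor. 2.9 / Thm. 4.7 / Thm. 3.3, BCS25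
Thm. 4.1.3, Rohrlich, Skinner–Urban Lemma 3.1.7 as `IwasawaAlgebra₂.spanLeIdeal_of_idealLeSpan_of_cycRestrict_eq`),
so the companion PROOFS file `OrdinaryTwoVariableMainStatementOfDivisibilityProofs.lean` (gen 8)
replays Thm. 10.10 (b) in the kernel from THIS binder: the preprint-specific content of 10.10 (b) is
exactly Thm. 10.5 (`∘ = ∅`).

## Printed statement (arXiv:2409.01350v2, pp. 87–88 [litref page file p0087–p0088]; label
## `KoMC'_lb`, tex l.7387–7404; print numbering §10.2.2 "An Eisenstein congruence divisibility")

"**Theorem 10.5.** Let `g ∈ S₂(Γ₀(N))` be an elliptic newform with `N` square-free and `p ∤ 2N` a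
prime. Let `L` be an imaginary quadratic field satisfying `(D_L, 2N) = 1` and (2.15). In the ordinary
case suppose that (irr_L) holds. Write `N = N⁺N⁻` for `N⁺` precisely divisible by split primes in `L`.
Suppose that either (def) Each prime dividing `N⁻` satisfies (ram) and `ν(N⁻)` is odd, or (indef) Each
prime dividing `N⁻ ≠ 1` satisfies (ram) and `ν(N⁻)` is even. Then for `∘ ∈ {+, −, ∅}`, one has
`𝓛_p^∘(g_{/L}) ∣ ξ(X_∘(g_{/L}))` in `Λ_{L,𝒪_λ}`. Moreover, the same holds for `g_K := g ⊗ χ_K` for any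
quadratic field extension `K/ℚ` with discriminant coprime to `Np`."

Printed proof (pp. 87–88, tex l.7405–7437), for the record of what the binder stands for: Thm. 9.24 (a)
gives `𝓛_p^Gr(g_{/L}) ∣ ξ(X_Gr^ur(g_{/L}))` in `Λ^ur_L ⊗_{Λ^{cyc,ur}} Frac(Λ^{cyc,ur})` ([W1]/[CLW] via
BSTW's explicit reciprocity laws; the gen-4 sibling binder `thm924_greenberg_dvd_charIdealXGr₂_awayFromCyc_OPEN`);
"by the proof of Proposition 9.20" the localised divisibility (print display (10.1), tex label
`tpm-div`) `𝓛_p^∘(g_{/L}) ∣ ξ(X_∘(g_{/L}))` in `Λ_L ⊗_{Λ^{cyc}} Frac(Λ^{cyc})`; then under (def):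
`ε(g_{/L}) = +1`, `μ(𝓛^∘_𝒲(g_{/L})) = 0` [PW = Pollack–Weston, Thm. 1.2] for the definite quaternionic
anticyclotomic `p`-adic `L`-function (see also [Va]), "In view of the interpolation formulas …
`(𝓛_p^{∘,ac}(g_{/L})) = (∏_{q∣N⁻} c_q(g) · 𝓛^∘_𝒲(g_{/L}))`" (UNDISPLAYED comparison, tex l.7427–7428;
ARM-P reading r03 NOTE-3 §4: watch item), the Tamagawa numbers being `p`-units under (ram), hence
`μ(𝓛_p^∘(g_{/L})) = 0`, "`𝓛_p^∘(g_{/L})` is coprime to height one prime ideals of `Λ^{cyc}_L`, and the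
divisibility (10.1) holds in `Λ_L`"; under (indef) the same with `μ(BDP) = 0` [Bu]. Remark 10.6 (p. 88,
l.7438–7440): "The hypothesis (indef) may be generalised as in [CLW, Thm. 8.2.3(2)]."

## What is typed here, and in which currency (E-instances `g = f_E`, `L = K`, `𝒪_λ = ℤ_p`, `∘ = ∅`)

* ONLY the ORDINARY case `∘ = ∅` (`X_∅ = X_ord`, `𝓛_p^∅ = 𝓛_p`; (9.8) p. 81: "`□ = ∅`, `• = ord` for
  `g` ordinary"): the signed objects `X_±(g_{/L})`, `𝓛_p^±(g_{/L})` of the supersingular case have no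
  two-variable carrier in the tree (cell census, GAP row "signed two-variable Selmer / `𝓛_p^±(g/L)`",
  unchanged since gen 3).
* Conclusion ↦ EXACTLY the `IdealLeSpan` clause of the sibling binder
  `thm1010b_standardMainStatement_twoVariable_OPEN` (and of the refereed
  `YanZhu2026.thm42_XOrd₂_isTorsion_charIdeal_le_perrinRiou`): for ANY pair `(κ₁, κ₂)` of
  `ℤ_p`-extensions of `K` with adapted generators `(γ₁, γ₂)` (`Λ_L = IwasawaAlgebra₂ p`), every modular
  parametrisation `π` of `W` at level `N` and EVERY `F` in Hida's type-I frame
  `IsHidaRankinLFunction ι W κ₁ κ₂ π.f F`, with `𝓛 = perrinRiouLFunction W π F = 𝓛_p^PR(E/K)`: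
  `Char(X) ⊂ (𝓛)` for `X = (W.baseChange K).XOrd₂ p κ₁ κ₂ γ₁ γ₂` — "`𝓛_p(g_{/L}) ∣ ξ(X(g_{/L}))` in `Λ_L`"
  (`𝓛 ∣ ξ` ⟺ `(ξ) ⊆ (𝓛)`). READING FLAG `BSTW-910-PR-normalisation` (the sibling's module docstring,
  verbatim: BSTW's `𝓛_p(g_{/L})` of §5.5.1 / Rem. 5.6 vs Perrin-Riou's `𝓛_p^PR` — same IDEAL of `Λ_L`
  for square-free `N`; cell reading). No torsion clause (Thm. 10.5 prints none; on this locus torsion of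
  `X(g_{/L})` is the REFEREED Yan–Zhu Cor. 2.9, `YanZhu2026.cor29_XOrd₂_isTorsion` — companion proofs
  file).
* Hypotheses ↦ the sibling's block `Thm1010bHypotheses W p N K` VERBATIM (`N = N_E` square-free ↦
  `Semistable W`; `p ∤ 2N`, ordinary case ↦ `p ≠ 2`, `GoodOrd W p`; `(D_L, 2N) = 1`; (2.15) = (ord) ↦ two
  primes of `K` over `p`; (irr_L) ↦ every `𝔽_p`-framing of `E[p]|_{G_K}` absolutely irreducible; (def) ∨
  (indef)). DELTA TO PRINT (numbers, not adjectives): the block carries ONE field Thm. 10.5 does not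
  list, `irrQ : W.HasIrreducibleModPGaloisRep p` = (irr_ℚ) of Thm. 10.10 — implied by (irr_L) (a
  `G_ℚ`-stable line of `E[p]` is `G_L`-stable; tree: Summits-side
  `hasIrreducibleModPGaloisRep_of_baseChange`), so the binder is print-EQUIVALENT and, as a hypothesis,
  WEAKER than print by exactly this redundant field. Reason for the choice: 10.5 and 10.10 (b) then share
  ONE hypothesis structure, and the kernel replay 10.5 ⟹ 10.10 (b) needs no glue.
* Twist clause ↦ as every sibling: hypotheses on the semistable `E₀` (model `W₀`, conductor `N₀`); `d ≠ 1`
  square-free with every prime ramified in `ℚ(√d)` `≠ p` and `∤ N₀` (`RamifiedInQuadratic`) = "discriminant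
  coprime to `Np`"; `W` a globally minimal model of `E₀^{(d)}` (`C • W = W₀.quadraticTwist d`) with a
  parametrisation `π` at ITS conductor `N`; conclusion `IdealLeSpan` for `(W, π)` over `L`.

NOT TYPED HERE (precisely): (i) `∘ ∈ {+, −}` (no carriers, above); (ii) the localised divisibility
(10.1) as a separate binder — it is implied by the integral one (`IdealLeSpan.awayFromPlus`, PROVED below
in the `S ⊂ Λ_K⁺` form of Yan–Zhu Cor. 4.6) and, at ORDINARY `p`, its derivation "9.24 (a) + proof of
Prop. 9.20" has the refereed shadow Yan–Zhu Thm. 4.7 (`thm47_…AnyRoot…`, the sibling 9.24 binder's `s`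
lives in `𝒪_{ℂ_p}⟦T₁⟧`, Thm. 4.7's in `Λ_K` — not composed here); (iii) Remark 10.6's generalisation of
(indef) ([CLW, Thm. 8.2.3 (2)]); (iv) the value frames of `𝓛_𝒲` (definite quaternionic) and of the
Shimura-curve BDP function behind the `μ = 0` step (GAP carriers; needed only for BSTW's PROOF).

RELATION TO THE SIBLING BINDERS (PROVED below, bookkeeping): the 9.10-`∅` binder of Thm. 10.10 (b)
IMPLIES this binder (`thm105_ordinary_OPEN_of_thm1010b_OPEN`; likewise the twist clauses) — as a
STATEMENT Thm. 10.5 (`∘ = ∅`) adds nothing to the tree's PRE debt beyond 10.10 (b); its value is as the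
upstream NODE from which 10.10 (b) is replayed (companion proofs file). Pricing is the referee desks'.

CONSUMERS: the companion proofs file (Thm. 10.10 (b) from 10.5); cell `bsd-ssimc` literal row D1, the
X9 / X11b lanes of `b2b-bsdres` ((indef) = Shimura-curve locus `N⁻ ≠ 1`), `bsd-cn100`; ARM P register
R-01 (the PRE residue of the zeta-element road); ideation (OPEN-QUESTIONS-01 §K).

## References
* [BurungaleSkinnerTianWan2024] arXiv:2409.01350v2: Thm. 10.5 (pp. 87–88; label `KoMC'_lb`, tex
  l.7387–7404), its proof (l.7405–7437; display (10.1) = label `tpm-div`), Rem. 10.6 (p. 88, l.7438–7440);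
  (def)/(indef) (l.7390–7396); (ram) (p. 84, l.7184); (ord) = (2.15) (l.1810); (irr_L) (l.1265); Thm. 10.8
  and its proof (pp. 88–89, l.7482–7514); Thm. 10.10 (p. 89, l.7519–7530); §5.5.1 (p. 55, l.4685–4705);
  Rem. 5.6 (p. 46, l.3904–3909); statement 9.10 (p. 81, l.6918–6927).
* [YanZhu2024MainConjNonCM] J. Algebra 693 (2026) = arXiv:2412.20078v4: Thm. 3.3, Def. 3.4, Cor. 2.9,
  Cor. 4.6, Thm. 4.7 — carriers and refereed neighbours (tree `YanZhu2026/TwoVariableMainTheorems.lean`).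
* [PollackWeston2011] R. Pollack, T. Weston, "On anticyclotomic μ-invariants of modular forms", Compos.
  Math. 147 (2011), Thm. 1.2 (BSTW's [PW]); [Vatsal2003] V. Vatsal, Duke Math. J. 116 (2003), Thm. 1.1
  (BSTW's [Va]); [Burungale2017] A. Burungale, "On the non-triviality of the `p`-adic Abel–Jacobi image
  …" II (BSTW's [Bu]); [CastellaLiuWan2022] Forum Math. Sigma 10 (2022) e110, Thm. 8.2.3 (2) (Rem. 10.6).
-/

noncomputable section

open scoped Classical

open PowerSeries NumberField IsDedekindDomain Field CongruenceSubgroup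
  Literature.NumberTheory.GaloisRepresentations Literature.NumberTheory.EllipticCurves
  Literature.NumberTheory.EllipticCurves.ModularForms Literature.NumberTheory.EllipticCurves.Rank1Residual

namespace Literature.NumberTheory.EllipticCurves.BurungaleSkinnerTianWan2024

open IwasawaAlgebra₂

/-! ### The OPEN binders: Thm. 10.5, ordinary case `∘ = ∅`, and its twist clause -/

/-- **OPEN HYPOTHESIS — UNREFEREED PREPRINT (arXiv:2409.01350v2), Thm. 10.5 ("An Eisenstein congruence
divisibility", pp. 87–88), ORDINARY case `∘ = ∅`, for `g = f_E`.** Under `Thm1010bHypotheses W p N K`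
(`N = N_E` square-free, `p ∤ 2N` good ordinary, (irr_ℚ) [implied by (irr_L); the one field print does not
list — module docstring "Hypotheses"], `L = K` imaginary quadratic with `(D_L, 2N) = 1`, (ord), (irr_L),
(def) or (indef)): "`𝓛_p(g_{/L}) ∣ ξ(X(g_{/L}))` in `Λ_{L,𝒪_λ}`". Transcribed (module docstring): for
ANY pair `(κ₁, κ₂)` of `ℤ_p`-extensions of `K` with adapted generators `(γ₁, γ₂)`, every modular
parametrisation `π` of `W` at level `N` and EVERY `F` in Hida's type-I frame
`IsHidaRankinLFunction ι W κ₁ κ₂ π.f F`, with `𝓛 = perrinRiouLFunction W π F`: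
`Char((W.baseChange K).XOrd₂ p κ₁ κ₂ γ₁ γ₂) ⊂ (𝓛)` (`IdealLeSpan`) — the one-sided half of the sibling
binder `thm1010b_standardMainStatement_twoVariable_OPEN`'s conclusion. READING FLAG
`BSTW-910-PR-normalisation` (sibling module docstring). NEVER cite this `Prop` as a theorem (no journal
version, 2026-08-27); take it as an explicit hypothesis. Its printed proof rests on Thm. 9.24 (a), the
proof of Prop. 9.20, and the `μ = 0` inputs [PW, Thm. 1.2] / [Va] under (def), [Bu] under (indef), with
an undisplayed interpolation comparison (tex l.7427–7428).
[claim: BurungaleSkinnerTianWan2024, status: under-review]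
[cite: BurungaleSkinnerTianWan2024, Thm. 10.5 (pp. 87–88; label KoMC'_lb, tex l.7387–7404; ANNOUNCED, OPEN binder), case ∘ = ∅, with §5.5.1 (p. 55, l.4685–4691) and Rem. 5.6 (p. 46, l.3904–3909)] -/
def thm105_ordinary_twoVariableDivisibility_OPEN : Prop :=
  ∀ {p : ℕ} [Fact p.Prime] (ι : integralClosure ℚ ℂ →+* ℂ_[p]) (W : WeierstrassCurve ℚ) [W.IsElliptic]
    [W.IsGloballyMinimal] (K : Type) [Field K] [NumberField K] (κ₁ κ₂ : ZpExtension K p)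
    (γ₁ γ₂ : absoluteGaloisGroup K) [Fact (ZpExtension.IsTopGeneratorPair κ₁ κ₂ γ₁ γ₂)]
    {N : ℕ} [NeZero N] (π : ModularParametrizationData W N),
    Thm1010bHypotheses W p N K →
      ∀ F : CycAntiSeries p, IsHidaRankinLFunction ι W κ₁ κ₂ π.f F →
        IdealLeSpan (WeierstrassCurve.XOrd₂.charIdeal (W.baseChange K) p κ₁ κ₂ γ₁ γ₂)
          (perrinRiouLFunction W π F)

/-- **OPEN HYPOTHESIS — UNREFEREED PREPRINT (arXiv:2409.01350v2), Thm. 10.5, QUADRATIC-TWIST clause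
(p. 88), ORDINARY case `∘ = ∅`.** "Moreover, the same holds for `g_K := g ⊗ χ_K` for any quadratic field
extension `K/ℚ` with discriminant coprime to `Np`." Transcribed (module docstring) as the sibling's twist
binders: hypotheses `Thm1010bHypotheses W₀ p N₀ K` on the semistable curve `E₀` (model `W₀`, conductor
`N₀`) and the imaginary quadratic `L = K`; the twist by `ℚ(√d)`, `d ≠ 1` square-free, every prime
ramified in `ℚ(√d)` `≠ p` and `∤ N₀` (`RamifiedInQuadratic`); `W` a globally minimal model of `E₀^{(d)}`
(`C • W = W₀.quadraticTwist d`) with a modular parametrisation `π` at ITS conductor `N`; conclusion: the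
`IdealLeSpan` shape for `(W, π)` over `L`. NEVER cite this `Prop` as a theorem; take it as an explicit
hypothesis (its proof in print rests on Thm. 9.24's twist clause — OPEN-QUESTIONS-01 Q17).
[claim: BurungaleSkinnerTianWan2024, status: under-review]
[cite: BurungaleSkinnerTianWan2024, Thm. 10.5, last sentence (p. 88; label KoMC'_lb, tex l.7403; ANNOUNCED, OPEN binder), case ∘ = ∅] -/
def thm105_twist_ordinary_twoVariableDivisibility_OPEN : Prop :=
  ∀ {p : ℕ} [Fact p.Prime] (ι : integralClosure ℚ ℂ →+* ℂ_[p]) (W₀ W : WeierstrassCurve ℚ)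
    [W₀.IsElliptic] [W₀.IsGloballyMinimal] [W.IsElliptic] [W.IsGloballyMinimal] (d : ℤ)
    (C : WeierstrassCurve.VariableChange ℚ) (K : Type) [Field K] [NumberField K]
    (κ₁ κ₂ : ZpExtension K p) (γ₁ γ₂ : absoluteGaloisGroup K)
    [Fact (ZpExtension.IsTopGeneratorPair κ₁ κ₂ γ₁ γ₂)] {N₀ N : ℕ} [NeZero N]
    (π : ModularParametrizationData W N),
    Thm1010bHypotheses W₀ p N₀ K →
    Squarefree d → d ≠ 1 → (∀ (q : ℕ) [Fact q.Prime], RamifiedInQuadratic d q → q ≠ p ∧ ¬ q ∣ N₀) →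
    C • W = W₀.quadraticTwist (d : ℚ) → (N : ℤ) = W.conductorNorm ℤ →
      ∀ F : CycAntiSeries p, IsHidaRankinLFunction ι W κ₁ κ₂ π.f F →
        IdealLeSpan (WeierstrassCurve.XOrd₂.charIdeal (W.baseChange K) p κ₁ κ₂ γ₁ γ₂)
          (perrinRiouLFunction W π F)

/-! ### Bookkeeping (binder ⇒ shape; sibling binder ⇒ binder), all CONDITIONAL; nothing is closed -/

section Bookkeeping

variable {p : ℕ} [Fact p.Prime] {K : Type} [Field K] [NumberField K]

/-- **Thm. 10.10 (b), statement 9.10 (`∅`), IMPLIES Thm. 10.5 (`∘ = ∅`)** — binder for binder: the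
divisibility is the `IdealLeSpan` half of the equality, under the same hypothesis block. So, as a
STATEMENT, this file's binder adds no PRE debt beyond the sibling's; it is the upstream node of the
printed proof. Pure logic. [claim: BurungaleSkinnerTianWan2024, status: under-review]
[cite: BurungaleSkinnerTianWan2024, Thm. 10.5 (pp. 87–88) and Thm. 10.10 (b) (p. 89) with statement 9.10 (b) (p. 81) (OPEN binders; bookkeeping)] -/
theorem thm105_ordinary_OPEN_of_thm1010b_OPEN
    (hBSTW_OPEN : thm1010b_standardMainStatement_twoVariable_OPEN) :
    thm105_ordinary_twoVariableDivisibility_OPEN := by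
  intro p _ ι W _ _ K _ _ κ₁ κ₂ γ₁ γ₂ _ N _ π hyp F hF
  exact ((hBSTW_OPEN ι W K κ₁ κ₂ γ₁ γ₂ π hyp).2 F hF).1

/-- **Thm. 10.10 (b), twist clause of statement 9.10 (`∅`), IMPLIES the twist clause of Thm. 10.5
(`∘ = ∅`)** — binder for binder. Pure logic. [claim: BurungaleSkinnerTianWan2024, status: under-review]
[cite: BurungaleSkinnerTianWan2024, Thm. 10.5, last sentence (p. 88) and Thm. 10.10, last sentence (p. 89) (OPEN binders; bookkeeping)] -/
theorem thm105_twist_ordinary_OPEN_of_thm1010b_twist_OPEN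
    (hBSTW_OPEN : thm1010b_twist_standardMainStatement_twoVariable_OPEN) :
    thm105_twist_ordinary_twoVariableDivisibility_OPEN := by
  intro p _ ι W₀ W _ _ _ _ d C K _ _ κ₁ κ₂ γ₁ γ₂ _ N₀ N _ π hyp hsq hd hram hC hN F hF
  exact ((hBSTW_OPEN ι W₀ W d C K κ₁ κ₂ γ₁ γ₂ π hyp hsq hd hram hC hN).2 F hF).1

/-- **Granted the binder: the printed localised divisibility (10.1)** (tex label `tpm-div`: "in
`Λ_L ⊗_{Λ^{cyc}_L} Frac(Λ^{cyc}_L)`") in the `S ⊂ Λ_K⁺`-form of Yan–Zhu Cor. 4.6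
(`IdealLeSpanAwayFromPlus`, witness `s = 1`). CONDITIONAL; closes nothing.
[claim: BurungaleSkinnerTianWan2024, status: under-review]
[cite: BurungaleSkinnerTianWan2024, Thm. 10.5, proof, display (10.1) (p. 88; tex label tpm-div, l.7414–7419) (OPEN binder; bookkeeping)] -/
theorem idealLeSpanAwayFromPlus_of_thm105_OPEN
    (hBSTW_OPEN : thm105_ordinary_twoVariableDivisibility_OPEN)
    (ι : integralClosure ℚ ℂ →+* ℂ_[p]) (W : WeierstrassCurve ℚ) [W.IsElliptic] [W.IsGloballyMinimal]
    (κ₁ κ₂ : ZpExtension K p) (γ₁ γ₂ : absoluteGaloisGroup K)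
    [Fact (ZpExtension.IsTopGeneratorPair κ₁ κ₂ γ₁ γ₂)] {N : ℕ} [NeZero N]
    (π : ModularParametrizationData W N) (hyp : Thm1010bHypotheses W p N K)
    {F : CycAntiSeries p} (hF : IsHidaRankinLFunction ι W κ₁ κ₂ π.f F) :
    IdealLeSpanAwayFromPlus (WeierstrassCurve.XOrd₂.charIdeal (W.baseChange K) p κ₁ κ₂ γ₁ γ₂)
      (perrinRiouLFunction W π F) :=
  (hBSTW_OPEN ι W K κ₁ κ₂ γ₁ γ₂ π hyp F hF).awayFromPlus

/-- **Granted the binder AND the reverse inclusion `(𝓛) ⊂ Char(X)` (from any source — e.g. the companion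
proofs file's kernel replay of Thm. 10.10 (b)): statement 9.10 (b) (`∅`) in the form "`Char(X(E/L_∞))` is
the principal ideal of `Λ_L` generated by an element mapping to `𝓛_p^PR(E/K)`"**
(`IdealLeSpan.eq_span_of_spanLeIdeal`). CONDITIONAL; closes nothing.
[claim: BurungaleSkinnerTianWan2024, status: under-review]
[cite: BurungaleSkinnerTianWan2024, Thm. 10.5 (pp. 87–88) with statement 9.10 (b) (p. 81) (OPEN binder; bookkeeping)] -/
theorem exists_charIdealXOrd₂_eq_span_of_thm105_OPEN_of_spanLeIdeal
    (hBSTW_OPEN : thm105_ordinary_twoVariableDivisibility_OPEN)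
    (ι : integralClosure ℚ ℂ →+* ℂ_[p]) (W : WeierstrassCurve ℚ) [W.IsElliptic] [W.IsGloballyMinimal]
    (κ₁ κ₂ : ZpExtension K p) (γ₁ γ₂ : absoluteGaloisGroup K)
    [Fact (ZpExtension.IsTopGeneratorPair κ₁ κ₂ γ₁ γ₂)] {N : ℕ} [NeZero N]
    (π : ModularParametrizationData W N) (hyp : Thm1010bHypotheses W p N K)
    {F : CycAntiSeries p} (hF : IsHidaRankinLFunction ι W κ₁ κ₂ π.f F)
    (hge : SpanLeIdeal (perrinRiouLFunction W π F)
      (WeierstrassCurve.XOrd₂.charIdeal (W.baseChange K) p κ₁ κ₂ γ₁ γ₂)) :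
    ∃ g ∈ WeierstrassCurve.XOrd₂.charIdeal (W.baseChange K) p κ₁ κ₂ γ₁ γ₂,
      toCycAnti p g = perrinRiouLFunction W π F ∧
        WeierstrassCurve.XOrd₂.charIdeal (W.baseChange K) p κ₁ κ₂ γ₁ γ₂ = Ideal.span {g} :=
  (hBSTW_OPEN ι W K κ₁ κ₂ γ₁ γ₂ π hyp F hF).eq_span_of_spanLeIdeal hge

/-- **Granted the twist binder: the localised form for the twist** (`IdealLeSpanAwayFromPlus`, `s = 1`).
CONDITIONAL; closes nothing. [claim: BurungaleSkinnerTianWan2024, status: under-review]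
[cite: BurungaleSkinnerTianWan2024, Thm. 10.5, last sentence and proof display (10.1) (p. 88) (OPEN binder; bookkeeping)] -/
theorem idealLeSpanAwayFromPlus_twist_of_thm105_twist_OPEN
    (hBSTW_OPEN : thm105_twist_ordinary_twoVariableDivisibility_OPEN)
    (ι : integralClosure ℚ ℂ →+* ℂ_[p]) (W₀ W : WeierstrassCurve ℚ) [W₀.IsElliptic]
    [W₀.IsGloballyMinimal] [W.IsElliptic] [W.IsGloballyMinimal] {d : ℤ}
    {C : WeierstrassCurve.VariableChange ℚ} (κ₁ κ₂ : ZpExtension K p) (γ₁ γ₂ : absoluteGaloisGroup K)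
    [Fact (ZpExtension.IsTopGeneratorPair κ₁ κ₂ γ₁ γ₂)] {N₀ N : ℕ} [NeZero N]
    (π : ModularParametrizationData W N) (hyp : Thm1010bHypotheses W₀ p N₀ K) (hsq : Squarefree d)
    (hd : d ≠ 1) (hram : ∀ (q : ℕ) [Fact q.Prime], RamifiedInQuadratic d q → q ≠ p ∧ ¬ q ∣ N₀)
    (hC : C • W = W₀.quadraticTwist (d : ℚ)) (hN : (N : ℤ) = W.conductorNorm ℤ)
    {F : CycAntiSeries p} (hF : IsHidaRankinLFunction ι W κ₁ κ₂ π.f F) :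
    IdealLeSpanAwayFromPlus (WeierstrassCurve.XOrd₂.charIdeal (W.baseChange K) p κ₁ κ₂ γ₁ γ₂)
      (perrinRiouLFunction W π F) :=
  (hBSTW_OPEN ι W₀ W d C K κ₁ κ₂ γ₁ γ₂ π hyp hsq hd hram hC hN F hF).awayFromPlus

end Bookkeeping

end Literature.NumberTheory.EllipticCurves.BurungaleSkinnerTianWan2024

end
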